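import Mathlib
import Summits.AtomisticToContinuum.Crystallization.Theorems.GappedShellCensusCleanLimitsHaveWindowsDefs

/-!
# The transversal defect is Lipschitz in the cluster

Stub `stub_defectLipschitz` (T3b-ii) of the skeleton `Lines/Sketch.lean` of the crux
`GappedShellCensus.CleanLimitsHaveWindows` (stmt-AtomisticToContinuum-15932), lead
prover-line-stmt-AtomisticToContinuum-15932-c1-0; vocabulary (`bondShell`, `slotC`, `slotH`, `clusterMisfit`,
`localDefect`) from `GappedShellCensusCleanLimitsHaveWindowsDefs`.

**Statement.** For `a > 0` there is `K` (depending only on `a`) such that, whenever the bond shells of `p` in `Z`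
and of `p'` in `Z'` correspond by a bijection `f` moving relative positions by at most `ε ≥ 0`, the transversal
defects satisfy `|localDefect a Z p - localDefect a Z' p'| ≤ K ε`.

**Proof.**
1. Re-indexing: `e ↦ f⁻¹ ∘ e` maps the labellings `↥(bondShell a Z p) ≃ Fin 12` ONTO the labellings of the
   shell of `p'` (`Function.Surjective.iInf_comp`), so both defects are infima over the same index types, of
   families that agree in the slot model and differ only in the cluster (`q k = e⁻¹ k` versus `q' k = f (e⁻¹ k)`).
2. Infima of non-negative real families and binary minima are `1`-Lipschitz for the sup norm
   (`dl_abs_iInf_sub_iInf_le`, `abs_min_sub_min_le_max`); the empty-index case is the junk value `0` on both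
   sides.
3. Pointwise (`dl_misfit_sub_le`): each of the `12` radial and `144` mutual squared residuals of `clusterMisfit`
   moves by at most `δ (2R + 2B)` where `δ` bounds the change of the distance (`ε` radially by
   `abs_norm_sub_norm_le`, `2ε` mutually by `dist_dist_dist_le`), `R` bounds the distances (`a (1 + 1/50)` resp.
   twice that, from the definition of the bond shell) and `B` the slot data (`‖slot k‖ ≤ 10 a` on the parameter
   box, `dl_slot_norm_le`, from `‖u‖ = ‖v‖ = a'`, `‖w‖ = a'/√3`, `‖h e₃‖ = |h|` and the triangle inequality).

The hypothesis `ε ≤ a` of the registered signature is not used. No new definitions.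
-/

noncomputable section

namespace Summit.AtomisticToContinuum.Crystallization.Theorems.CleanHull

open Literature.MathematicalPhysics.StatisticalMechanics

/-! ## Two order lemmas -/

/-- Infima of non-negative real families over the same index type are `1`-Lipschitz for the sup norm:
`|⨅ u - ⨅ v| ≤ M` if `|u i - v i| ≤ M` for all `i` (for an empty index both sides are the junk `0`, whence the
hypothesis `0 ≤ M`). [folklore] -/
theorem dl_abs_iInf_sub_iInf_le {ι : Sort*} {u v : ι → ℝ} {M : ℝ} (hM : 0 ≤ M) (hu : ∀ i, 0 ≤ u i)
    (hv : ∀ i, 0 ≤ v i) (h : ∀ i, |u i - v i| ≤ M) : |(⨅ i, u i) - ⨅ i, v i| ≤ M := by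
  rcases isEmpty_or_nonempty ι with hι | hι
  · simpa using hM
  have hbu : BddBelow (Set.range u) := ⟨0, by rintro _ ⟨i, rfl⟩; exact hu i⟩
  have hbv : BddBelow (Set.range v) := ⟨0, by rintro _ ⟨i, rfl⟩; exact hv i⟩
  rw [abs_sub_le_iff]
  constructor
  · have key : (⨅ i, u i) - M ≤ ⨅ i, v i := le_ciInf fun i => by
      have h1 := ciInf_le hbu i
      have h2 := (abs_sub_le_iff.1 (h i)).1
      linarith
    linarith
  · have key : (⨅ i, v i) - M ≤ ⨅ i, u i := le_ciInf fun i => by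
      have h1 := ciInf_le hbv i
      have h2 := (abs_sub_le_iff.1 (h i)).2
      linarith
    linarith

/-- Stability of a squared residual: if `|x - y| ≤ δ`, `x, y ∈ [0, R]` and `s ∈ [0, B]` then
`|(x - s)² - (y - s)²| = |x - y| · |x + y - 2s| ≤ δ (2R + 2B)`. [folklore] -/
theorem dl_abs_sq_sub_sq_le {x y s δ R B : ℝ} (hxy : |x - y| ≤ δ) (hx0 : 0 ≤ x) (hx : x ≤ R)
    (hy0 : 0 ≤ y) (hy : y ≤ R) (hs0 : 0 ≤ s) (hs : s ≤ B) :
    |(x - s) ^ 2 - (y - s) ^ 2| ≤ δ * (2 * R + 2 * B) := by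
  rw [show (x - s) ^ 2 - (y - s) ^ 2 = (x - y) * (x + y - 2 * s) by ring, abs_mul]
  refine mul_le_mul hxy ?_ (abs_nonneg _) ((abs_nonneg _).trans hxy)
  rw [abs_le]
  constructor <;> linarith

/-! ## Norm bounds for the slot model on the parameter box -/

/-- `‖(x, y, z)‖² = x² + y² + z²` in `ℝ³`. [folklore] -/
theorem dl_norm_sq_vec3 (x y z : ℝ) :
    ‖(!₂[x, y, z] : EuclideanSpace ℝ (Fin 3))‖ ^ 2 = x ^ 2 + y ^ 2 + z ^ 2 := by
  rw [EuclideanSpace.norm_sq_eq, Fin.sum_univ_three]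
  simp [sq_abs]

/-- A vector whose squared norm is at most `C²` (`C ≥ 0`) has norm at most `C`. [folklore] -/
theorem dl_norm_le_of_sq_le {v : EuclideanSpace ℝ (Fin 3)} {C : ℝ} (hC : 0 ≤ C) (h : ‖v‖ ^ 2 ≤ C ^ 2) :
    ‖v‖ ≤ C :=
  (pow_le_pow_iff_left₀ (norm_nonneg _) hC two_ne_zero).1 h

/-- On the parameter box (`0 ≤ a' ≤ 2a`, `0 ≤ h ≤ 2a`) the building blocks `u, v, w, h e₃` of the slot model have
norm `≤ 2a`. [folklore] -/
theorem dl_blocks_norm_le {a a' h : ℝ} (ha'0 : 0 ≤ a') (ha' : a' ≤ 2 * a) (hh0 : 0 ≤ h) (hh : h ≤ 2 * a) :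
    ‖triangularVec₁ a'‖ ≤ 2 * a ∧ ‖triangularVec₂ a'‖ ≤ 2 * a ∧ ‖barlowOffset a'‖ ≤ 2 * a ∧
      ‖h • layerNormal 1‖ ≤ 2 * a := by
  have h2a : 0 ≤ 2 * a := ha'0.trans ha'
  have hsq : a' ^ 2 ≤ (2 * a) ^ 2 := pow_le_pow_left₀ ha'0 ha' 2
  have hsq' : h ^ 2 ≤ (2 * a) ^ 2 := pow_le_pow_left₀ hh0 hh 2
  have h3 : (√3 : ℝ) ^ 2 = 3 := Real.sq_sqrt (by norm_num)
  -- `‖u‖² = ‖v‖² = a'²`, `‖w‖² = a'²/3`, `‖h e₃‖² = h²`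
  have e1 : ‖triangularVec₁ a'‖ ^ 2 = a' ^ 2 := by
    rw [triangularVec₁, dl_norm_sq_vec3]; ring
  have e2 : ‖triangularVec₂ a'‖ ^ 2 = a' ^ 2 := by
    rw [triangularVec₂, dl_norm_sq_vec3]; linear_combination (a' ^ 2 / 4) * h3
  have e3 : ‖barlowOffset a'‖ ^ 2 = a' ^ 2 / 3 := by
    rw [barlowOffset, dl_norm_sq_vec3]; linear_combination (a' ^ 2 / 36) * h3
  have e4 : ‖h • layerNormal 1‖ ^ 2 = h ^ 2 := by
    rw [norm_smul, mul_pow, layerNormal, dl_norm_sq_vec3, Real.norm_eq_abs, sq_abs]; ring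
  refine ⟨dl_norm_le_of_sq_le h2a ?_, dl_norm_le_of_sq_le h2a ?_, dl_norm_le_of_sq_le h2a ?_,
    dl_norm_le_of_sq_le h2a ?_⟩
  · rw [e1]; exact hsq
  · rw [e2]; exact hsq
  · rw [e3]; nlinarith [sq_nonneg a']
  · rw [e4]; exact hsq'

/-- **Slot vectors are bounded on the parameter box**: for `0 ≤ a' ≤ 2a` and heights `h⁺, h⁻ ∈ [0, 2a]`, every
slot vector of either local type has norm `≤ 10a` (each is a signed sum of at most three building blocks of norm
`≤ 2a`). [folklore] -/
theorem dl_slot_norm_le {a a' hp hm : ℝ} (ha'0 : 0 ≤ a') (ha' : a' ≤ 2 * a) (hp0 : 0 ≤ hp)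
    (hp2 : hp ≤ 2 * a) (hm0 : 0 ≤ hm) (hm2 : hm ≤ 2 * a) (k : Fin 12) :
    ‖slotC a' hp hm k‖ ≤ 10 * a ∧ ‖slotH a' hp hm k‖ ≤ 10 * a := by
  obtain ⟨hu, hv, hw, hP⟩ := dl_blocks_norm_le ha'0 ha' hp0 hp2
  have hM := (dl_blocks_norm_le ha'0 ha' hm0 hm2).2.2.2
  have n1 := norm_nonneg (triangularVec₁ a')
  have n2 := norm_nonneg (triangularVec₂ a')
  have n3 := norm_nonneg (barlowOffset a')
  have n4 := norm_nonneg (hp • layerNormal 1)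
  have n5 := norm_nonneg (hm • layerNormal 1)
  have e1 := norm_neg (triangularVec₁ a')
  have e2 := norm_neg (triangularVec₂ a')
  have e3 := norm_sub_le (triangularVec₁ a') (triangularVec₂ a')
  have e4 := norm_sub_le (triangularVec₂ a') (triangularVec₁ a')
  have e5 := norm_add_le (hp • layerNormal 1) (barlowOffset a')
  have e6 := norm_sub_le (hp • layerNormal 1 + barlowOffset a') (triangularVec₁ a')
  have e7 := norm_sub_le (hp • layerNormal 1 + barlowOffset a') (triangularVec₂ a')
  have e8 := norm_neg (hm • layerNormal 1)
  have e9 := norm_sub_le (-(hm • layerNormal 1)) (barlowOffset a')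
  have e10 := norm_add_le (-(hm • layerNormal 1) - barlowOffset a') (triangularVec₁ a')
  have e11 := norm_add_le (-(hm • layerNormal 1) - barlowOffset a') (triangularVec₂ a')
  have e12 := norm_add_le (-(hm • layerNormal 1)) (barlowOffset a')
  have e13 := norm_sub_le (-(hm • layerNormal 1) + barlowOffset a') (triangularVec₁ a')
  have e14 := norm_sub_le (-(hm • layerNormal 1) + barlowOffset a') (triangularVec₂ a')
  fin_cases k <;> dsimp only [slotC, slotH, Fin.reduceFinMk, Matrix.cons_val] <;> constructor <;> linarith

/-! ## Pointwise stability of the cluster misfit -/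

/-- **Pointwise stability of the misfit.** If the radial distances of two labelled clusters are `≤ R`, the slot
vectors have norm `≤ B`, and the relative positions differ label by label by `≤ ε`, then the misfits against the
same slot model differ by `≤ (12 (2R + 2B) + 288 (4R + 4B)) ε`. [folklore] -/
theorem dl_misfit_sub_le {p p' : EuclideanSpace ℝ (Fin 3)} {q q' slot : Fin 12 → EuclideanSpace ℝ (Fin 3)}
    {ε R B : ℝ} (hq : ∀ k, dist (q k) p ≤ R) (hq' : ∀ k, dist (q' k) p' ≤ R) (hB : ∀ k, ‖slot k‖ ≤ B)
    (hε : ∀ k, dist (q' k - p') (q k - p) ≤ ε) :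
    |clusterMisfit p q slot - clusterMisfit p' q' slot| ≤
      (12 * (2 * R + 2 * B) + 288 * (4 * R + 4 * B)) * ε := by
  -- radial residuals move by `≤ ε (2R + 2B)`
  have hrad : ∀ k, |(dist (q k) p - ‖slot k‖) ^ 2 - (dist (q' k) p' - ‖slot k‖) ^ 2| ≤
      ε * (2 * R + 2 * B) := by
    intro k
    refine dl_abs_sq_sub_sq_le ?_ dist_nonneg (hq k) dist_nonneg (hq' k) (norm_nonneg _) (hB k)
    rw [dist_eq_norm, dist_eq_norm]
    refine (abs_norm_sub_norm_le _ _).trans ?_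
    rw [← dist_eq_norm, dist_comm]
    exact hε k
  -- mutual residuals move by `≤ 2ε (4R + 4B)`
  have hmut : ∀ k l, |(dist (q k) (q l) - dist (slot k) (slot l)) ^ 2 -
      (dist (q' k) (q' l) - dist (slot k) (slot l)) ^ 2| ≤ 2 * ε * (2 * (2 * R) + 2 * (2 * B)) := by
    intro k l
    refine dl_abs_sq_sub_sq_le ?_ dist_nonneg ?_ dist_nonneg ?_ dist_nonneg ?_
    · rw [← dist_sub_right (q k) (q l) p, ← dist_sub_right (q' k) (q' l) p', ← Real.dist_eq]
      refine (dist_dist_dist_le _ _ _ _).trans ?_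
      rw [dist_comm (q k - p), dist_comm (q l - p)]
      linarith [hε k, hε l]
    · linarith [dist_triangle_right (q k) (q l) p, hq k, hq l]
    · linarith [dist_triangle_right (q' k) (q' l) p', hq' k, hq' l]
    · linarith [dist_le_norm_add_norm (slot k) (slot l), hB k, hB l]
  have hsum1 : |∑ k, ((dist (q k) p - ‖slot k‖) ^ 2 - (dist (q' k) p' - ‖slot k‖) ^ 2)| ≤
      12 * (ε * (2 * R + 2 * B)) :=
    (Finset.abs_sum_le_sum_abs _ _).trans ((Finset.sum_le_sum fun k _ => hrad k).trans_eq (by simp))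
  have hsum2i : ∀ k, |∑ l, ((dist (q k) (q l) - dist (slot k) (slot l)) ^ 2 -
      (dist (q' k) (q' l) - dist (slot k) (slot l)) ^ 2)| ≤ 12 * (2 * ε * (2 * (2 * R) + 2 * (2 * B))) :=
    fun k => (Finset.abs_sum_le_sum_abs _ _).trans
      ((Finset.sum_le_sum fun l _ => hmut k l).trans_eq (by simp))
  have hsum2 : |∑ k, ∑ l, ((dist (q k) (q l) - dist (slot k) (slot l)) ^ 2 -
      (dist (q' k) (q' l) - dist (slot k) (slot l)) ^ 2)| ≤
      12 * (12 * (2 * ε * (2 * (2 * R) + 2 * (2 * B)))) :=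
    (Finset.abs_sum_le_sum_abs _ _).trans ((Finset.sum_le_sum fun k _ => hsum2i k).trans_eq (by simp))
  have hsplit : clusterMisfit p q slot - clusterMisfit p' q' slot =
      ∑ k, ((dist (q k) p - ‖slot k‖) ^ 2 - (dist (q' k) p' - ‖slot k‖) ^ 2) +
      ∑ k, ∑ l, ((dist (q k) (q l) - dist (slot k) (slot l)) ^ 2 -
        (dist (q' k) (q' l) - dist (slot k) (slot l)) ^ 2) := by
    simp only [clusterMisfit, Finset.sum_sub_distrib]
    ring
  rw [hsplit]
  refine (abs_add_le _ _).trans ?_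
  linarith

/-! ## The stub -/

/-- **Stub T3b-ii (the transversal defect is Lipschitz in the cluster).** If the bond shells of `p` in `Z` and
of `p'` in `Z'` correspond by a bijection moving relative positions by `≤ ε ≤ a`, the transversal defects differ
by `≤ K ε` (every residual is a difference of bounded distances; `156` squared residuals; `inf`/`min` are
`1`-Lipschitz). [folklore] -/
theorem stub_defectLipschitz (a : ℝ) (ha : 0 < a) : ∃ K : ℝ, ∀ (Z Z' : Set (EuclideanSpace ℝ (Fin 3)))
    (p p' : EuclideanSpace ℝ (Fin 3)) (ε : ℝ), 0 ≤ ε → ε ≤ a →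
    (∃ f : ↥(bondShell a Z p) ≃ ↥(bondShell a Z' p'),
      ∀ w : ↥(bondShell a Z p), dist ((f w : EuclideanSpace ℝ (Fin 3)) - p') ((w : EuclideanSpace ℝ (Fin 3)) - p) ≤ ε) →
    |localDefect a Z p - localDefect a Z' p'| ≤ K * ε := by
  refine ⟨12 * (2 * (a * (1 + 1 / 50)) + 2 * (10 * a)) + 288 * (4 * (a * (1 + 1 / 50)) + 4 * (10 * a)), ?_⟩
  rintro Z Z' p p' ε hε - ⟨f, hf⟩
  have hK : 0 ≤ (12 * (2 * (a * (1 + 1 / 50)) + 2 * (10 * a)) +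
      288 * (4 * (a * (1 + 1 / 50)) + 4 * (10 * a))) * ε := by positivity
  have hsurj : Function.Surjective (fun e : ↥(bondShell a Z p) ≃ Fin 12 => f.symm.trans e) :=
    fun e' => ⟨f.trans e', by ext x; simp⟩
  unfold localDefect
  rw [← hsurj.iInf_comp]
  refine dl_abs_iInf_sub_iInf_le hK
    (fun e => Real.iInf_nonneg fun _ => le_min (clusterMisfit_nonneg _ _ _) (clusterMisfit_nonneg _ _ _))
    (fun e => Real.iInf_nonneg fun _ => le_min (clusterMisfit_nonneg _ _ _) (clusterMisfit_nonneg _ _ _))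
    fun e => ?_
  refine dl_abs_iInf_sub_iInf_le hK (fun θ => le_min (clusterMisfit_nonneg _ _ _) (clusterMisfit_nonneg _ _ _))
    (fun θ => le_min (clusterMisfit_nonneg _ _ _) (clusterMisfit_nonneg _ _ _)) fun θ => ?_
  obtain ⟨⟨a', hp, hm⟩, ha'1, ha'2, hp0, hp2, hm0, hm2⟩ := θ
  have ha'0 : 0 ≤ a' := by linarith
  have hq : ∀ k, dist ((e.symm k : EuclideanSpace ℝ (Fin 3))) p ≤ a * (1 + 1 / 50) := fun k => by
    rw [dist_comm]; exact (e.symm k).2.2.2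
  have hq' : ∀ k, dist ((f (e.symm k) : EuclideanSpace ℝ (Fin 3))) p' ≤ a * (1 + 1 / 50) := fun k => by
    rw [dist_comm]; exact (f (e.symm k)).2.2.2
  have hεk : ∀ k, dist ((f (e.symm k) : EuclideanSpace ℝ (Fin 3)) - p')
      ((e.symm k : EuclideanSpace ℝ (Fin 3)) - p) ≤ ε := fun k => hf (e.symm k)
  exact (abs_min_sub_min_le_max _ _ _ _).trans (max_le
    (dl_misfit_sub_le hq hq' (fun k => (dl_slot_norm_le ha'0 ha'2 hp0 hp2 hm0 hm2 k).1) hεk)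
    (dl_misfit_sub_le hq hq' (fun k => (dl_slot_norm_le ha'0 ha'2 hp0 hp2 hm0 hm2 k).2) hεk))

end Summit.AtomisticToContinuum.Crystallization.Theorems.CleanHull

end
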